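import Summits.KontsevichZagierPeriods.KontsevichZagierPeriods.Theorems.TerasomaMultiplicationGammaHodgeSectorDefs
import Summits.KontsevichZagierPeriods.KontsevichZagierPeriods.Theses.CompiledSubstitutions
import Literature.NumberTheory.Transcendental.KZBetaChains
import Literature.NumberTheory.Transcendental.KZDirichletCharts

/-!
# `GammaHodgeSector` (stmt-KontsevichZagierPeriods-3742), line `koblitz-ogus-halving` — stub `stub_betaRelators`

The ELEMENTARY STANDARD RELATORS among Beta classes `betaClass a b = ⟦[(0,1), t^{a-1}(1-t)^{b-1}]⟧`
in the formal period ring `P = KZ.FormalPeriodRing`, each realised as an honest chain of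
Kontsevich–Zagier moves (all side conditions discharged):

* symmetry `β(a,b) = β(b,a)` — one change of variables `t ↦ 1 − t`
  (`KZ.betaReflection_equivalent`);
* translation `β(a,b) = ((a+b)/a)·β(a+1,b)` — integration by parts as ONE Newton–Leibniz move with
  the primitive `t^b(1-t)^a` (`KZ.betaTranslation_equivalent` at `(b,a)`: `(a+b)·β(b,a+1) ∼ a·β(b,a)`),
  symmetry, and the invertible constants `κ(q) = ⟦[pt, q]⟧`
  (`toFormalPeriod (of (r.constMul q)) = κ(q)·⟦r⟧`);
* unit `β(1,1) = 1` — `[(0,1), 1]` is pinned with the constant kernel over `[pt, 1]`;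
* Dirichlet re-association `β(a,b)β(a+b,c) = β(b,c)β(a,b+c)` — the two Fubini products are the box
  representations of the polar / linear charts of the Dirichlet simplex
  (`KZ.dirichletPolar_equivalent`, `KZ.dirichletLinear_equivalent`);
* Euler reflection `β(a,1−a) = κ((sin πa)⁻¹)·β(½,½)` from the route item `EulerReflectionRational`
  (stmt-KontsevichZagierPeriods-3383, hypothesis) and `[β(½,½)] ∼ [π]`
  (`equivalent_betaHalfRep_piRep`).

References: Kontsevich–Zagier 2001 §1.1–1.2; Andrews–Askey–Roy 1999 §1.1, Thm 1.8.1.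
-/

noncomputable section

open MeasureTheory Set
open scoped BigOperators

namespace Summit.KontsevichZagierPeriods.GammaHodgeSectorKO

open Literature.NumberTheory.Transcendental Literature.NumberTheory.Transcendental.KZ
  Literature.NumberTheory.Transcendental.BetaSymbol
open Summit.KontsevichZagierPeriods.KontsevichZagierPeriods.Theses.CompiledSubstitutions
  (EulerReflectionRational)
open Summit.KontsevichZagierPeriods.KontsevichZagierPeriods.BetaCancellationNegative
  (betaKernel betaKernel_one_one IsPinned pinDomain pinFun betaHalfRep equivalent_betaHalfRep_piRep
   equivalent_of_isPinned_one mem_unitIoo)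
open Literature.NumberTheory.Transcendental.KZreg (unitIoo)

/-! ## Stub `stub_betaRelators`: the elementary Beta relators as chains of moves -/

/-- `⟦[σ, q·f]⟧ = κ(q) · ⟦[σ, f]⟧`: `[pt, q] × [σ, f]` IS the relabelling of `[σ, q f]` along
`Fin n ≃ Fin (0 + n)` (one change of variables away). [folklore] -/
private theorem toFormalPeriod_of_constMul {n : ℕ} (r : IntegralRep n) (q : ℝ)
    (hq : IsAlgebraic ℚ q) :
    toFormalPeriod (of (r.constMul q hq)) = kap q hq * toFormalPeriod (of r) := by
  rw [kap, toFormalPeriod_of_mul_of]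
  apply toFormalPeriod_eq_iff.mpr
  have hcoord : ∀ (w : Fin (0 + n) → ℝ),
      (fun j => w (Fin.natAdd 0 j)) = fun i => w (finCongr (Nat.zero_add n).symm i) := by
    intro w; funext j; simp
  have key : (IntegralRep.unit.constMul q hq).prod r =
      (r.constMul q hq).reindex (finCongr (Nat.zero_add n).symm) := by
    refine IntegralRep.ext' ?_ ?_
    · ext w
      simp only [IntegralRep.prod_domain, IntegralRep.mem_prodDomain, IntegralRep.domain_constMul,
        IntegralRep.unit_domain, mem_univ, true_and, IntegralRep.reindex_domain, mem_setOf_eq, hcoord]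
    · rw [IntegralRep.prod_integrand_eq, IntegralRep.reindex_integrand]
      funext w
      simp only [IntegralRep.prodFun_apply, IntegralRep.integrand_constMul,
        IntegralRep.unit_integrand, mul_one, hcoord]
  rw [key]
  exact of_sub_of_reindex_mem_relations _ _

/-- SYMMETRY `β(a,b) = β(b,a)` in `P`: one change of variables `t ↦ 1 − t`
(`KZ.betaReflection_equivalent`). [cite: AndrewsAskeyRoy1999, §1.1] -/
private theorem betaClass_symm (a b : ℚ) (ha : 0 < a) (hb : 0 < b) :
    betaClass a b = betaClass b a := by
  rw [betaClass_eq a b ha hb, betaClass_eq b a hb ha]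
  exact (KZ.betaReflection_equivalent ((a:ℝ) - 1) ((b:ℝ) - 1) (betaRep a b ha hb)
    (betaRep b a hb ha) rfl (fun _ _ => rfl) rfl (fun _ _ => rfl)).toFormalPeriod_eq

/-- UNIT `β(1,1) = 1` in `P`: `[(0,1), 1]` is pinned with the constant kernel `1` over `[pt, 1]`,
hence equivalent to it (slab move, rotation, null boundary). [folklore] -/
private theorem betaClass_one_one : betaClass 1 1 = 1 := by
  rw [betaClass_eq 1 1 one_pos one_pos, ← toFormalPeriod_of_unit]
  have hpin : IsPinned (fun _ => (1:ℝ)) IntegralRep.unit (betaRep 1 1 one_pos one_pos) := by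
    refine ⟨?_, fun z _ => ?_⟩
    · ext z
      simp only [betaRep_domain, pinDomain, IntegralRep.unit_domain, mem_univ, and_true,
        mem_setOf_eq]
      exact Iff.rfl
    · simp [pinFun]
  exact (equivalent_of_isPinned_one hpin).toFormalPeriod_eq

/-- TRANSLATION `β(a,b) = ((a+b)/a)·β(a+1,b)` in `P`: the integration-by-parts chain
`(a+b)·β(b,a+1) ∼ a·β(b,a)` (`KZ.betaTranslation_equivalent`), symmetry, and the invertibility of
the constants `κ`. [cite: AndrewsAskeyRoy1999, §1.1] -/
private theorem betaClass_translation (a b : ℚ) (ha : 0 < a) (hb : 0 < b) :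
    IsConstMultiple (betaClass a b) (betaClass (a + 1) b) := by
  have ha1 : 0 < a + 1 := by linarith
  have hqa : IsAlgebraic ℚ ((a:ℚ):ℝ) := isAlgebraic_algebraMap a
  have hqab : IsAlgebraic ℚ (((a + b : ℚ)):ℝ) := isAlgebraic_algebraMap (a + b)
  set ρ := (betaRep b (a + 1) hb ha1).constMul (((a + b : ℚ)):ℝ) hqab with hρ
  set ρ' := (betaRep b a hb ha).constMul ((a:ℚ):ℝ) hqa with hρ'
  have hρρ' : Equivalent ρ ρ' := by
    refine KZ.betaTranslation_equivalent b a hb ha ρ ρ' rfl (fun x _ => ?_) rfl (fun x _ => ?_)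
    · simp only [hρ, IntegralRep.integrand_constMul, betaRep_integrand, betaKernel]
      rw [show (((a + 1 : ℚ)) : ℝ) - 1 = (a:ℝ) by push_cast; ring]
      push_cast
      ring
    · simp only [hρ', IntegralRep.integrand_constMul, betaRep_integrand, betaKernel]
  have h1 : kap _ hqab * betaClass b (a + 1) = kap _ hqa * betaClass b a := by
    rw [betaClass_eq b (a + 1) hb ha1, betaClass_eq b a hb ha, ← toFormalPeriod_of_constMul,
      ← toFormalPeriod_of_constMul]
    exact hρρ'.toFormalPeriod_eq
  rw [betaClass_symm b (a + 1) hb ha1, betaClass_symm b a hb ha] at h1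
  have ha0 : ((a:ℚ):ℝ) ≠ 0 := by exact_mod_cast ha.ne'
  have hpos : (0:ℝ) < (((a + b) / a : ℚ) : ℝ) := by
    have : 0 < (a + b) / a := div_pos (by linarith) ha
    exact_mod_cast this
  refine ⟨(((a + b) / a : ℚ) : ℝ), isAlgebraic_algebraMap _, hpos, ?_⟩
  calc betaClass a b = kap _ hqa.inv * (kap _ hqa * betaClass a b) := by
        rw [← mul_assoc, mul_comm (kap _ hqa.inv), kap_mul_kap_inv hqa ha0, one_mul]
    _ = kap _ hqa.inv * (kap _ hqab * betaClass (a + 1) b) := by rw [h1]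
    _ = kap _ (hqa.inv.mul hqab) * betaClass (a + 1) b := by rw [← mul_assoc, ← kap_mul]
    _ = _ := by
        congr 1
        exact kap_congr _ _ (by push_cast; rw [inv_mul_eq_div])

/-- `Fin.castAdd 1 0 = 0` in `Fin (1+1)`. [folklore] -/
private theorem castAdd_one_zero : (Fin.castAdd 1 (0 : Fin 1) : Fin (1 + 1)) = 0 := rfl

/-- `Fin.natAdd 1 0 = 1` in `Fin (1+1)`. [folklore] -/
private theorem natAdd_one_zero : (Fin.natAdd 1 (0 : Fin 1) : Fin (1 + 1)) = 1 := rfl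

/-- The domain of a product of two `(0,1)`-representations is the open box. [folklore] -/
private theorem prod_domain_eq_box (κ β : IntegralRep 1) (hκ : κ.domain = unitIoo)
    (hβ : β.domain = unitIoo) :
    (κ.prod β).domain = {z : Fin 2 → ℝ | z 0 ∈ Set.Ioo (0:ℝ) 1 ∧ z 1 ∈ Set.Ioo (0:ℝ) 1} := by
  ext z
  simp only [IntegralRep.prod_domain, IntegralRep.mem_prodDomain, hκ, hβ, mem_unitIoo, mem_setOf_eq,
    castAdd_one_zero, natAdd_one_zero]

/-- The integrand of a product of two Beta representations, coordinatewise. [folklore] -/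
private theorem betaRep_prod_integrand (a b a' b' : ℚ) (ha : 0 < a) (hb : 0 < b) (ha' : 0 < a')
    (hb' : 0 < b') (z : Fin (1 + 1) → ℝ) :
    ((betaRep a b ha hb).prod (betaRep a' b' ha' hb')).integrand z =
      (z 0) ^ ((a:ℝ) - 1) * (1 - z 0) ^ ((b:ℝ) - 1) * ((z 1) ^ ((a':ℝ) - 1) * (1 - z 1) ^ ((b':ℝ) - 1)) := by
  rw [IntegralRep.prod_integrand_eq]
  simp only [IntegralRep.prodFun, betaRep_integrand, castAdd_one_zero, natAdd_one_zero, betaKernel]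

/-- DIRICHLET RE-ASSOCIATION `β(a,b)β(a+b,c) = β(b,c)β(a,b+c)` in `P`: the Fubini products are
the two box representations of `KZ.dirichletPolar_equivalent` / `KZ.dirichletLinear_equivalent`,
both one change of variables away from the Dirichlet simplex representation
`[Δ, x^{a-1}y^{b-1}(1-x-y)^{c-1}]`. [cite: AndrewsAskeyRoy1999, Thm 1.8.1] -/
private theorem betaClass_dirichlet (a b c : ℚ) (ha : 0 < a) (hb : 0 < b) (hc : 0 < c) :
    betaClass a b * betaClass (a + b) c = betaClass b c * betaClass a (b + c) := by
  have hab : 0 < a + b := by linarith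
  have hbc : 0 < b + c := by linarith
  rw [mul_comm (betaClass a b), betaClass_eq (a + b) c hab hc, betaClass_eq a b ha hb,
    betaClass_eq b c hb hc, betaClass_eq a (b + c) ha hbc, toFormalPeriod_of_mul_of,
    toFormalPeriod_of_mul_of]
  apply Equivalent.toFormalPeriod_eq
  obtain ⟨S, hSd, hSi, hPS⟩ := KZ.dirichletPolar_equivalent a b c
    ((betaRep (a + b) c hab hc).prod (betaRep a b ha hb)) (prod_domain_eq_box _ _ rfl rfl)
    (fun z _ => by rw [betaRep_prod_integrand]; push_cast; ring_nf)
  refine hPS.trans (KZ.dirichletLinear_equivalent a b c S _ hSd hSi (prod_domain_eq_box _ _ rfl rfl)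
    (fun z _ => ?_))
  rw [betaRep_prod_integrand]
  push_cast
  ring_nf

/-- EULER REFLECTION `β(a,1−a) = β(½,½)/sin πa` in `P` from `EulerReflectionRational`
(stmt-KontsevichZagierPeriods-3383): `sin(πa)·[β(a,1−a)] ∼ [disc, 1] ∼ [β(½,½)]`
(`equivalent_betaHalfRep_piRep`), and `κ(sin πa)` is invertible. [cite: AndrewsAskeyRoy1999, §1.2] -/
private theorem betaClass_reflection (hR : EulerReflectionRational) (a : ℚ) (ha : 0 < a) (ha1 : a < 1) :
    IsConstMultiple (betaClass a (1 - a)) (betaClass (1 / 2) (1 / 2)) := by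
  have h1a : 0 < 1 - a := by linarith
  have hs : IsAlgebraic ℚ (Real.sin (Real.pi * a)) := by
    have h := Real.isAlgebraic_sin_rat_mul_pi a
    rw [mul_comm] at h
    exact h.extendScalars (RingHom.injective_int (algebraMap ℤ ℚ))
  have hs0 : 0 < Real.sin (Real.pi * a) := by
    have ha' : (0:ℝ) < a := by exact_mod_cast ha
    have ha1' : (a:ℝ) < 1 := by exact_mod_cast ha1
    refine Real.sin_pos_of_pos_of_lt_pi (by positivity) ?_
    nlinarith [Real.pi_pos]
  set r := (betaRep a (1 - a) ha h1a).constMul (Real.sin (Real.pi * a)) hs with hr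
  have hE : Equivalent r piRep := by
    refine hR a ha ha1 r piRep rfl (fun x _ => ?_) rfl (fun _ _ => rfl)
    simp only [hr, IntegralRep.integrand_constMul, betaRep_integrand, betaKernel]
    rw [show (((1 - a : ℚ)) : ℝ) - 1 = -(a:ℝ) by push_cast; ring]
    ring
  have hhalf : IsBetaRep (1 / 2) (1 / 2) betaHalfRep := ⟨rfl, fun _ _ => rfl⟩
  have key : kap _ hs * betaClass a (1 - a) = betaClass (1 / 2) (1 / 2) := by
    rw [betaClass_eq a (1 - a) ha h1a, ← toFormalPeriod_of_constMul,
      ← hhalf.toFormalPeriod_eq (by norm_num) (by norm_num)]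
    exact (hE.trans equivalent_betaHalfRep_piRep.symm).toFormalPeriod_eq
  refine ⟨(Real.sin (Real.pi * a))⁻¹, hs.inv, inv_pos.2 hs0, ?_⟩
  rw [← key, ← mul_assoc, mul_comm (kap _ hs.inv), kap_mul_kap_inv hs hs0.ne', one_mul]

/-- STUB (elementary Beta relators as chains). Symmetry (one change of variables), translation
(integration by parts = Newton–Leibniz with a monomial primitive), unit, Dirichlet re-association
(two changes of variables through the simplex), and Euler reflection from `EulerReflectionRational`
(stmt-KontsevichZagierPeriods-3383). [cite: AndrewsAskeyRoy1999, §1.1, Thm 1.8.1] -/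
theorem stub_betaRelators :
    (∀ a b : ℚ, 0 < a → 0 < b → betaClass a b = betaClass b a) ∧
    (∀ a b : ℚ, 0 < a → 0 < b → IsConstMultiple (betaClass a b) (betaClass (a + 1) b)) ∧
    betaClass 1 1 = 1 ∧
    (∀ a b c : ℚ, 0 < a → 0 < b → 0 < c →
      betaClass a b * betaClass (a + b) c = betaClass b c * betaClass a (b + c)) ∧
    (EulerReflectionRational → ∀ a : ℚ, 0 < a → a < 1 →
      IsConstMultiple (betaClass a (1 - a)) (betaClass (1 / 2) (1 / 2))) := by
  exact ⟨betaClass_symm, betaClass_translation, betaClass_one_one, betaClass_dirichlet,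
    betaClass_reflection⟩

end Summit.KontsevichZagierPeriods.GammaHodgeSectorKO
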